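import Summits.AnomalousDissipation.AnomalousDissipation.Theorems.BaireTransferRobustLoudUpgradeStubLsFamilyPeriodicC

/-!
# Stub `stub_lsFoldPeriodic` (crux stmt-AnomalousDissipation-1144, companion c3), part A: lemmas for the FOLD OF CYCLES —
# the kernel field of the free-period linearisation realised classically with its multiplier (`kernelField`), the second-order
# inhomogeneity `μ ∂₀W + (W·∇ₓ)W` on `T⁴` (coefficients, zero modes, unrolling: `secondOrderField`), and the derivative of the
# Lyapunov–Schmidt identities (registered ending `lsFoldPeriodic_partA`, abstract: `T̂ (Dυ(0,1)) = 0`, `φ₂ (Dυ(0,1)) = 1`).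
# Pure proof file; notations verbatim from `PeriodicNSOrbitPersistsProofs`.  Refs: Kielhöfer 2012 §I.12–I.13; Chow–Hale 1982 Ch. 9; Iooss 1972 §3.
-/


-- `Summit.<Summit>.<Problem>` is the tree's mandated summit-side namespace (CONVENTIONS §2); for this
-- single-conjunct summit the two coincide, so the duplicate is deliberate.
set_option linter.dupNamespace false

noncomputable section

open scoped BigOperators Topology ENNReal NNReal ComplexConjugate
open Filter Set Function MeasureTheory UnitAddTorus

namespace Summit.AnomalousDissipation.AnomalousDissipation.Theorems.RobustLoudUpgrade.LsFamilyPeriodic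

open Literature.Analysis.FunctionSpaces Literature.Analysis.FunctionSpaces.Torus
open Literature.Analysis.FunctionSpaces.EuclideanSpace
open Literature.Analysis.FluidPDE
open Literature.Analysis.FluidPDE.ScalarFourier
open Literature.Analysis.FluidPDE.TimePeriodicLattice
open Summit.AnomalousDissipation.AnomalousDissipation.Theses.BaireTransfer

-- NOTATION START (verbatim from `PeriodicNSOrbitPersistsProofs`)
/-- Local notation: the parabolic weight `Λ(n, k) = |n| + |k|²`. -/
local notation:max "Λ" m:max => (|((Prod.fst m : ℤ) : ℝ)| + freqNormSq (Prod.snd m))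

/-- Local notation: the convective symbol on `ℤ × ℤ³` (as in `TimePeriodicNSLattice`). -/
local notation:max "𝐍[" a ", " b "]" m:max =>
  (WithLp.toLp 2 (fun p : Fin 3 => ∑ j : Fin 3, ∑' m' : ℤ × (Fin 3 → ℤ),
    a m' j * (dsym j (Prod.snd m - Prod.snd m') * b (m - m') p)) : EuclideanSpace ℂ (Fin 3))

/-- Local notation: division by the weight. -/
local notation:max "𝐜" x:max => (fun mm : ℤ × (Fin 3 → ℤ) =>
  ((((|((Prod.fst mm : ℤ) : ℝ)| + freqNormSq (Prod.snd mm))⁻¹ : ℝ) : ℂ) • x mm))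

/-- Local notation: multiplication by the weight. -/
local notation:max "𝐬" x:max => (fun mm : ℤ × (Fin 3 → ℤ) =>
  ((((|((Prod.fst mm : ℤ) : ℝ)| + freqNormSq (Prod.snd mm)) : ℝ) : ℂ) • x mm))

/-- Local notation: the family of coefficients of `x ∈ W ⊂ ℓ²`. -/
local notation:max "𝐰" x:max =>
  (((x : lp (fun _ : ℤ × (Fin 3 → ℤ) => EuclideanSpace ℂ (Fin 3)) 2)) : ℤ × (Fin 3 → ℤ) → EuclideanSpace ℂ (Fin 3))

/-- Local notation: the extension `K ↦ c (K₀, tail K)` of a lattice family to `ℤ⁴`. -/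
local notation:max "𝐄" c:max => (fun K : Fin 4 → ℤ => c ((K 0, Fin.tail K) : ℤ × (Fin 3 → ℤ)))

/-- Local notation: the lattice family `û(n,k) = 𝓕(complexify ∘ (U − m₀))(n,k)`. -/
local notation:max "𝐮[" U ", " m₀ "]" => (fun mm : ℤ × (Fin 3 → ℤ) =>
  mFourierCoeff (EuclideanSpace.complexify ∘ fun y : UnitAddTorus (Fin 4) => U y - m₀)
    (Fin.cons (Prod.fst mm) (Prod.snd mm) : Fin 4 → ℤ))

/-- Local notation: the force family `y_F(n,k) = [k ≠ 0][n = 0] 𝓕(complexify ∘ F)(k)`. -/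
local notation:max "𝐲" F:max => (fun mm : ℤ × (Fin 3 → ℤ) =>
  (ite (Prod.snd mm = 0) (0 : EuclideanSpace ℂ (Fin 3))
    (ite (Prod.fst mm = 0) (mFourierCoeff (EuclideanSpace.complexify ∘ F) (Prod.snd mm)) 0)))

/-- Local notation: the lattice family of the orbit `u` with period `τ`. -/
local notation:max "𝐨[" τ ", " u "]" => (fun mm : ℤ × (Fin 3 → ℤ) =>
  mFourierCoeff (EuclideanSpace.complexify ∘ fun y : UnitAddTorus (Fin 4) => Torus.timeRoll τ u y - ∫ x, u 0 x)
    (Fin.cons (Prod.fst mm) (Prod.snd mm) : Fin 4 → ℤ))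
/-- Local notation: the time multiplier `dₛ(n,k) = 2πi n / Λ(n,k)`. -/
local notation "dS" => (fun mm : ℤ × (Fin 3 → ℤ) =>
  (2 * Real.pi * Complex.I * ((Prod.fst mm : ℤ) : ℂ)) * ((((|((Prod.fst mm : ℤ) : ℝ)| + freqNormSq (Prod.snd mm)) : ℝ) : ℂ))⁻¹)

/-- Local notation: the Stokes–drift multiplier `(4π²ν|k|² + 2πi m₀·k) / Λ(n,k)`. -/
local notation "dL[" ν ", " m₀ "]" => (fun mm : ℤ × (Fin 3 → ℤ) =>
  (((4 * Real.pi ^ 2 * ν * freqNormSq (Prod.snd mm) : ℝ) : ℂ) +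
      2 * Real.pi * Complex.I * (∑ jj : Fin 3, ((m₀ jj : ℝ) : ℂ) * (((Prod.snd mm) jj : ℤ) : ℂ))) *
    ((((|((Prod.fst mm : ℤ) : ℝ)| + freqNormSq (Prod.snd mm)) : ℝ) : ℂ))⁻¹)

/-- Local notation: the symbol `σ_om(n,k) = 2πiomn + 4π²ν|k|² + 2πi m₀·k`. -/
local notation "σ[" om ", " ν ", " m₀ "]" => (fun mm : ℤ × (Fin 3 → ℤ) =>
  2 * Real.pi * Complex.I * ((om : ℝ) : ℂ) * ((Prod.fst mm : ℤ) : ℂ) +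
    (((4 * Real.pi ^ 2 * ν * freqNormSq (Prod.snd mm) : ℝ)) : ℂ) +
    2 * Real.pi * Complex.I * (∑ jj : Fin 3, ((m₀ jj : ℝ) : ℂ) * (((Prod.snd mm) jj : ℤ) : ℂ)))
-- NOTATION END

variable {W : Submodule ℝ (lp (fun _ : ℤ × (Fin 3 → ℤ) => EuclideanSpace ℂ (Fin 3)) 2)}

/-! ## §1 The kernel field of the free-period linearisation, realised classically with its multiplier -/

section KernelField

variable {ν τ : ℝ} {f : UnitAddTorus (Fin 3) → EuclideanSpace ℝ (Fin 3)}
  {u : ℝ → UnitAddTorus (Fin 3) → EuclideanSpace ℝ (Fin 3)} {p : ℝ → UnitAddTorus (Fin 3) → ℝ}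

variable (hW : ∀ x : lp (fun _ : ℤ × (Fin 3 → ℤ) => EuclideanSpace ℂ (Fin 3)) 2, x ∈ W ↔
      (∀ n : ℤ, (x : ℤ × (Fin 3 → ℤ) → EuclideanSpace ℂ (Fin 3)) (n, 0) = 0) ∧
      (∀ mm : ℤ × (Fin 3 → ℤ), (∑ jj : Fin 3, ((mm.2 jj : ℤ) : ℂ) *
        ((x : ℤ × (Fin 3 → ℤ) → EuclideanSpace ℂ (Fin 3)) mm) jj) = 0) ∧
      (∀ mm : ℤ × (Fin 3 → ℤ), (x : ℤ × (Fin 3 → ℤ) → EuclideanSpace ℂ (Fin 3)) (-mm) =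
        conjVec ((x : ℤ × (Fin 3 → ℤ) → EuclideanSpace ℂ (Fin 3)) mm)))
variable {Ds L₀ : W →L[ℝ] W} (hDs : ∀ (x : W) (m : ℤ × (Fin 3 → ℤ)), (𝐰 (Ds x)) m = dS m • (𝐰 x) m)
  (hL₀ : ∀ (x : W) (m : ℤ × (Fin 3 → ℤ)), (𝐰 (L₀ x)) m = dL[ν, ∫ x, u 0 x] m • (𝐰 x) m)
variable {B : W → W → W} (hBf : ∀ (x y : W) (m : ℤ × (Fin 3 → ℤ)), (𝐰 (B x y)) m = Torus.lerayCoeff m.2 (𝐍[𝐜 (𝐰 x), 𝐜 (𝐰 y)] m))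

include hW hDs hL₀ hBf in
/-- **The kernel field, realised classically with its multiplier.**  A lattice solution `k ∈ W` of `T k + μ ∂ₛx₀ = 0`
(`T = τ⁻¹∂ₛ + L₀ + B(x₀,·) + B(·,x₀)`) is the weighted family of a REAL smooth `τ`-periodic field `w` on `ℝ × T³` — the
unrolling of `W = Re F_{k/Λ}` on `T⁴` — which solves the linearised problem forced by `(−μτ) ∂ₜu`; its coefficient family is
`k/Λ`. [folklore] -/
theorem kernelField (hν : 0 < ν) (hτ : 0 < τ) (hsol : Torus.IsClassicalNSSolutionOn univ ν (fun _ => f) u p)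
    (hper : Function.Periodic u τ) (hf0 : HasZeroMean f) (x₀ : W) (hx₀ : 𝐰 x₀ = 𝐬 (𝐨[τ, u])) (k : W) (μ : ℝ)
    (heqW : τ⁻¹ • Ds k + L₀ k + (B x₀ k + B k x₀) = (-μ) • Ds x₀) :
    RapidDecay (𝐄 (𝐜 (𝐰 k))) ∧
    IsSmooth (fun y : UnitAddTorus (Fin 4) => EuclideanSpace.realPart (fourierSynth (𝐄 (𝐜 (𝐰 k))) y)) ∧
    (complexify ∘ fun y : UnitAddTorus (Fin 4) => EuclideanSpace.realPart (fourierSynth (𝐄 (𝐜 (𝐰 k))) y)) = fourierSynth (𝐄 (𝐜 (𝐰 k))) ∧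
    (∀ m : ℤ × (Fin 3 → ℤ), mFourierCoeff (complexify ∘ fun y : UnitAddTorus (Fin 4) =>
        EuclideanSpace.realPart (fourierSynth (𝐄 (𝐜 (𝐰 k))) y)) (Fin.cons m.1 m.2) = (𝐜 (𝐰 k)) m) ∧
    IsSmoothSpaceTimeOn univ (fun t : ℝ => fun x : UnitAddTorus (Fin 3) =>
        EuclideanSpace.realPart (fourierSynth (𝐄 (𝐜 (𝐰 k))) (Fin.cons (((τ⁻¹ * t : ℝ)) : UnitAddCircle) x))) ∧
    Function.Periodic (fun t : ℝ => fun x : UnitAddTorus (Fin 3) =>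
        EuclideanSpace.realPart (fourierSynth (𝐄 (𝐜 (𝐰 k))) (Fin.cons (((τ⁻¹ * t : ℝ)) : UnitAddCircle) x))) τ ∧
    (fun t : ℝ => fun x : UnitAddTorus (Fin 3) => Torus.realToComplex
        (EuclideanSpace.realPart (fourierSynth (𝐄 (𝐜 (𝐰 k))) (Fin.cons (((τ⁻¹ * t : ℝ)) : UnitAddCircle) x)))) ∈
      linPeriodicSol ν u τ (fun t x => ((((-μ : ℝ) : ℂ) * (τ : ℂ))) • velocityDot u t x) := by
  have hU : IsSmooth (timeRoll τ u) := orbit_isSmooth hsol hper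
  have hu0 := orbit_zero_modes hsol hper hf0
  have hut := orbit_transversal hsol hper
  have hY : ∀ m, (𝐰 (((-μ) • Ds x₀ : W))) m = ((-μ : ℝ) : ℂ) • ((2 * Real.pi * Complex.I * (m.1 : ℂ)) • 𝐨[τ, u] m) :=
    fun m => by rw [coe_smul_Ds_orbit hDs hsol hper hf0 x₀ hx₀ (-μ) m, Complex.ofReal_neg]
  obtain ⟨heq, hhr⟩ := linear_core hW hDs hL₀ hBf hν hτ hsol hper hf0 x₀ hx₀ k ((-μ) • Ds x₀) (b := ((-μ : ℝ) : ℂ)) hY heqW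
  have hh0 : ∀ n : ℤ, (𝐜 (𝐰 k)) (n, 0) = 0 := cw_zero_mode (W_zero hW k)
  have hht : ∀ mm : ℤ × (Fin 3 → ℤ), (∑ jj : Fin 3, ((mm.2 jj : ℤ) : ℂ) * ((𝐜 (𝐰 k)) mm) jj) = 0 := cw_transversal (W_trans hW k)
  have hcs : ∀ mm : ℤ × (Fin 3 → ℤ), (𝐜 (𝐰 k)) (-mm) = conjVec ((𝐜 (𝐰 k)) mm) := cw_neg (W_conj hW k)
  obtain ⟨Q, hQ, hE⟩ := linear_rolledUp_of_coeff (U := timeRoll τ u) (m₀ := ∫ x, u 0 x) (h := 𝐜 (𝐰 k))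
    (b := ((-μ : ℝ) : ℂ)) hU hu0 hut hh0 hht hhr heq
  obtain ⟨hsw, hsq, hdivC, hmeanC, hperw, hEq⟩ := linear_classical (ν := ν) hτ hsol.smooth_velocity hper
    hhr.isSmooth_fourierSynth hQ hE (div_synth_eq_zero (h := 𝐜 (𝐰 k)) hht hhr)
    (integral_timeSlice_synth_eq_zero (h := 𝐜 (𝐰 k)) hh0 hhr)
  obtain ⟨hV's, hreal, hVcoef⟩ := realSynth_spec' hhr (ext_neg_eq_conjVec (c := 𝐜 (𝐰 k)) hcs)
  -- the real field has the same unrolling as the complex synthesis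
  have hfun : (fun t : ℝ => fun x : UnitAddTorus (Fin 3) => Torus.realToComplex
      (EuclideanSpace.realPart (fourierSynth (𝐄 (𝐜 (𝐰 k))) (Fin.cons (((τ⁻¹ * t : ℝ)) : UnitAddCircle) x)))) =
      fun t : ℝ => fun x : UnitAddTorus (Fin 3) => fourierSynth (𝐄 (𝐜 (𝐰 k))) (Fin.cons (((τ⁻¹ * t : ℝ)) : UnitAddCircle) x) := by
    funext t x
    have := congrArg (fun F : UnitAddTorus (Fin 4) → EuclideanSpace ℂ (Fin 3) => F (Fin.cons (((τ⁻¹ * t : ℝ)) : UnitAddCircle) x)) hreal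
    simp only [Function.comp_apply] at this
    rw [SteadyLattice.realToComplex_eq_complexify]
    exact this
  refine ⟨hhr, hV's, hreal, fun m => ?_, ?_, ?_, ?_⟩
  · rw [hVcoef]
    simp only [Fin.cons_zero, Fin.tail_cons, Prod.mk.eta]
  · have h1 := isSmoothSpaceTimeOn_cons hV's τ⁻¹
    exact h1
  · have h1 := periodic_comp_cons (fun y : UnitAddTorus (Fin 4) => EuclideanSpace.realPart (fourierSynth (𝐄 (𝐜 (𝐰 k))) y))
      (inv_ne_zero hτ.ne')
    rw [inv_inv] at h1
    exact h1
  · rw [hfun]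
    exact ⟨hsw, hdivC, hmeanC, hperw, _, hsq, fun t x => hEq t x⟩

include hW in
/-- **A kernel field proportional to `∂ₜu` comes from a multiple of the phase vector**: if the unrolled synthesis of `k/Λ` is
`z ∂ₜu`, then `𝐰 k = (z τ⁻¹) • 𝐰 g` coefficientwise (`g = (2πi n) x₀`). [folklore] -/
theorem coe_eq_smul_phase_of_synth_eq (hτ : 0 < τ) (hsu : IsSmoothSpaceTimeOn univ u) (hper : Function.Periodic u τ) (g : W)
    (hg : 𝐰 g = fun mm : ℤ × (Fin 3 → ℤ) => (2 * Real.pi * Complex.I * (mm.1 : ℂ)) • (𝐬 (𝐨[τ, u])) mm)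
    (k : W) (hhr : RapidDecay (𝐄 (𝐜 (𝐰 k)))) {z : ℂ}
    (hz : ∀ t x, fourierSynth (𝐄 (𝐜 (𝐰 k))) (Fin.cons (((τ⁻¹ * t : ℝ)) : UnitAddCircle) x) =
      z • Torus.realToComplex (Torus.timeDerivWithin univ u t x)) :
    ∀ m : ℤ × (Fin 3 → ℤ), (𝐰 k) m = (z * ((τ⁻¹ : ℝ) : ℂ)) • (𝐰 g) m := by
  intro m
  have hcoef := coeff_eq_of_synth_eq_smul_timeDeriv (h := 𝐜 (𝐰 k)) hτ hsu hper hhr (∫ x, u 0 x) hz m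
  have e1 := congrArg (fun F : ℤ × (Fin 3 → ℤ) → EuclideanSpace ℂ (Fin 3) => F m) (sw_cw (x := 𝐰 k) (W_zero hW k))
  simp only at e1
  rw [← e1, hcoef, hg]
  simp only [smul_smul]
  congr 1
  ring

end KernelField

/-! ## §2 The second-order inhomogeneity `μ ∂₀W + (W·∇ₓ)W` of a real smooth field on `T⁴` -/

section SecondOrder

variable {τ : ℝ}

/-- **The second-order field**: for a real smooth `W` on `T⁴` with lattice coefficient family `ŵ` (zero spatial modes vanishing,
transversal, rapidly decaying extension), the complex field `Hc = μ ∂₀W_ℂ + ∑ⱼ (W_ℂ)ⱼ ∂ⱼ₊₁ W_ℂ` is smooth, its zero spatial modes vanish,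
and `𝓕Hc(n,k) = μ (2πi n) ŵ(n,k) + N(ŵ, ŵ)(n,k)`. [folklore] -/
theorem secondOrderField {Wr : UnitAddTorus (Fin 4) → EuclideanSpace ℝ (Fin 3)} (hWr : IsSmooth Wr)
    {w : ℤ × (Fin 3 → ℤ) → EuclideanSpace ℂ (Fin 3)}
    (hw : ∀ m : ℤ × (Fin 3 → ℤ), mFourierCoeff (complexify ∘ Wr) (Fin.cons m.1 m.2) = w m)
    (hw0 : ∀ n : ℤ, w (n, 0) = 0)
    (hwt : ∀ m : ℤ × (Fin 3 → ℤ), (∑ jj : Fin 3, ((m.2 jj : ℤ) : ℂ) * (w m) jj) = 0) (hwr : RapidDecay (𝐄 w)) (μ : ℝ) :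
    IsSmooth (fun y => (μ : ℂ) • (complexify ∘ Torus.partialDeriv 0 Wr) y +
        ∑ j : Fin 3, ((complexify ∘ Wr) y) j • Torus.partialDeriv (Fin.succ j) (complexify ∘ Wr) y) ∧
    (∀ n : ℤ, mFourierCoeff (fun y => (μ : ℂ) • (complexify ∘ Torus.partialDeriv 0 Wr) y +
        ∑ j : Fin 3, ((complexify ∘ Wr) y) j • Torus.partialDeriv (Fin.succ j) (complexify ∘ Wr) y) (Fin.cons n (0 : Fin 3 → ℤ)) = 0) ∧
    (∀ m : ℤ × (Fin 3 → ℤ), mFourierCoeff (fun y => (μ : ℂ) • (complexify ∘ Torus.partialDeriv 0 Wr) y +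
        ∑ j : Fin 3, ((complexify ∘ Wr) y) j • Torus.partialDeriv (Fin.succ j) (complexify ∘ Wr) y) (Fin.cons m.1 m.2) =
        (μ : ℂ) • ((2 * Real.pi * Complex.I * (m.1 : ℂ)) • w m) + 𝐍[w, w] m) := by
  have hWc : IsSmooth (complexify ∘ Wr) := hWr.comp_clm complexify.toContinuousLinearMap
  have hdc : IsSmooth (complexify ∘ Torus.partialDeriv 0 Wr) := (hWr.partialDeriv 0).comp_clm complexify.toContinuousLinearMap
  have hT : IsSmooth (fun y => ∑ j : Fin 3, ((complexify ∘ Wr) y) j • Torus.partialDeriv (Fin.succ j) (complexify ∘ Wr) y) :=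
    isSmooth_transport hWc hWc
  have hS : IsSmooth (fun y => (μ : ℂ) • (complexify ∘ Torus.partialDeriv 0 Wr) y +
      ∑ j : Fin 3, ((complexify ∘ Wr) y) j • Torus.partialDeriv (Fin.succ j) (complexify ∘ Wr) y) :=
    (isSmooth_smul_complex (isSmooth_const _) hdc).add hT
  -- coefficients
  have hLw : (fun mm : ℤ × (Fin 3 → ℤ) => mFourierCoeff (complexify ∘ Wr) (Fin.cons mm.1 mm.2 : Fin 4 → ℤ)) = w := funext hw
  have hcoef : ∀ m : ℤ × (Fin 3 → ℤ), mFourierCoeff (fun y => (μ : ℂ) • (complexify ∘ Torus.partialDeriv 0 Wr) y +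
      ∑ j : Fin 3, ((complexify ∘ Wr) y) j • Torus.partialDeriv (Fin.succ j) (complexify ∘ Wr) y) (Fin.cons m.1 m.2) =
      (μ : ℂ) • ((2 * Real.pi * Complex.I * (m.1 : ℂ)) • w m) + 𝐍[w, w] m := by
    intro m
    have e : (fun y => (μ : ℂ) • (complexify ∘ Torus.partialDeriv 0 Wr) y +
        ∑ j : Fin 3, ((complexify ∘ Wr) y) j • Torus.partialDeriv (Fin.succ j) (complexify ∘ Wr) y) =
        ((μ : ℂ) • (complexify ∘ Torus.partialDeriv 0 Wr)) +
          (fun y => ∑ j : Fin 3, ((complexify ∘ Wr) y) j • Torus.partialDeriv (Fin.succ j) (complexify ∘ Wr) y) := by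
      funext y; simp
    rw [e, mFourierCoeff_add (hdc.integrable.smul _) hT.integrable, mFourierCoeff_const_smul,
      coeff_partialDeriv_zero (m₀ := (0 : EuclideanSpace ℝ (Fin 3))) hWr m, mFourierCoeff_transport_cons hWc hWc m.1 m.2, hLw]
    congr 2
    have := hw m
    simp only [sub_zero] at this ⊢
    rw [← this]
  refine ⟨hS, fun n => ?_, hcoef⟩
  rw [show (Fin.cons n (0 : Fin 3 → ℤ) : Fin 4 → ℤ) = Fin.cons ((n, (0 : Fin 3 → ℤ)) : ℤ × (Fin 3 → ℤ)).1
    ((n, (0 : Fin 3 → ℤ)) : ℤ × (Fin 3 → ℤ)).2 from rfl, hcoef (n, 0), hw0 n, smul_zero, smul_zero, zero_add]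
  exact nl_cons_zero_of_rapidDecayE hwt hwr hwr n

end SecondOrder

/-! ## Registered part A (abstract, notation-free): the derivative of the Lyapunov–Schmidt identities -/

section Abstract

/-- **Registered sub-goal `lsFoldPeriodic_partA`** (companion c3): differentiating the Lyapunov–Schmidt identities
`N (υ q) + frc q.1 − σ q • e = 0`, `φ₂ (υ q − u₀) = q.2` at `q = (c, 0)` along the kernel coordinate: `T (Dυ (0,1)) = ℓ (0,1) • e`
(so `= 0` when the kernel direction is invisible at first order) and `φ₂ (Dυ (0,1)) = 1`. [folklore] -/
theorem lsFoldPeriodic_partA : ∀ (X Y P : Type) [NormedAddCommGroup X] [NormedSpace ℝ X] [NormedAddCommGroup Y] [NormedSpace ℝ Y] [NormedAddCommGroup P] [NormedSpace ℝ P] (N : X → Y) (T : X →L[ℝ] Y) (frc : P →L[ℝ] Y) (e : Y) (φ₂ : X →L[ℝ] ℝ) (σ : P × ℝ → ℝ) (υ : P × ℝ → X) (ℓ : P × ℝ →L[ℝ] ℝ) (Dυ : P × ℝ →L[ℝ] X) (u₀ : X) (c : P) (r : ℝ), HasFDerivAt N T u₀ → υ (c, 0) = u₀ → HasFDerivAt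 σ ℓ (c, 0) → HasFDerivAt υ Dυ (c, 0) → 0 < r → (∀ q ∈ Metric.ball ((c, 0) : P × ℝ) r, N (υ q) + frc q.1 - σ q • e = 0 ∧ φ₂ (υ q - u₀) = q.2) → T (Dυ (0, 1)) = ℓ (0, 1) • e ∧ φ₂ (Dυ (0, 1)) = 1 := by
  intro X Y P _ _ _ _ _ _ N T frc e φ₂ σ υ ℓ Dυ u₀ c r hN hυ0 hσ hυ hr hsol
  have hball : Metric.ball ((c, 0) : P × ℝ) r ∈ 𝓝 ((c, 0) : P × ℝ) := Metric.isOpen_ball.mem_nhds (Metric.mem_ball_self hr)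
  -- first identity
  have hF : HasFDerivAt (fun q : P × ℝ => N (υ q) + frc q.1 - σ q • e)
      (T.comp Dυ + frc.comp (ContinuousLinearMap.fst ℝ P ℝ) - ℓ.smulRight e) (c, 0) := by
    have h1 : HasFDerivAt (fun q : P × ℝ => N (υ q)) (T.comp Dυ) (c, 0) := by
      have hN' : HasFDerivAt N T (υ (c, 0)) := by rw [hυ0]; exact hN
      exact hN'.comp (c, 0) hυ
    have h2 : HasFDerivAt (fun q : P × ℝ => frc q.1) (frc.comp (ContinuousLinearMap.fst ℝ P ℝ)) (c, 0) :=
      frc.hasFDerivAt.comp (c, 0) hasFDerivAt_fst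
    have h3 : HasFDerivAt (fun q : P × ℝ => σ q • e) (ℓ.smulRight e) (c, 0) := hσ.smul_const e
    exact (h1.add h2).sub h3
  have hF0 : HasFDerivAt (fun q : P × ℝ => N (υ q) + frc q.1 - σ q • e) (0 : P × ℝ →L[ℝ] Y) (c, 0) := by
    refine (hasFDerivAt_const (0 : Y) ((c, 0) : P × ℝ)).congr_of_eventuallyEq ?_
    filter_upwards [hball] with q hq
    exact (hsol q hq).1
  have hD := hF.unique hF0
  have h1 := DFunLike.congr_fun hD ((0 : P), (1 : ℝ))
  simp only [sub_apply, add_apply, ContinuousLinearMap.comp_apply,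
    ContinuousLinearMap.coe_fst', map_zero, add_zero, ContinuousLinearMap.smulRight_apply, zero_apply,
    sub_eq_zero] at h1
  -- second identity
  have hG : HasFDerivAt (fun q : P × ℝ => φ₂ (υ q - u₀)) (φ₂.comp Dυ) (c, 0) := by
    have ha : HasFDerivAt (fun q : P × ℝ => υ q - u₀) Dυ (c, 0) := hυ.sub_const u₀
    exact φ₂.hasFDerivAt.comp (c, 0) ha
  have hG0 : HasFDerivAt (fun q : P × ℝ => φ₂ (υ q - u₀)) (ContinuousLinearMap.snd ℝ P ℝ) (c, 0) := by
    refine (hasFDerivAt_snd (𝕜 := ℝ) (E := P) (F := ℝ) (p := ((c, 0) : P × ℝ))).congr_of_eventuallyEq ?_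
    filter_upwards [hball] with q hq
    exact (hsol q hq).2
  have hD2 := hG.unique hG0
  have h2 := DFunLike.congr_fun hD2 ((0 : P), (1 : ℝ))
  simp only [ContinuousLinearMap.comp_apply, ContinuousLinearMap.coe_snd'] at h2
  exact ⟨h1, h2⟩

end Abstract

end Summit.AnomalousDissipation.AnomalousDissipation.Theorems.RobustLoudUpgrade.LsFamilyPeriodic

end
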